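import Summits.RiemannHypothesis.RiemannHypothesis.Theorems.EtaTailTrialBoundDefs
import Summits.RiemannHypothesis.RiemannHypothesis.Theorems.EtaTailTrialBoundLockingLayerRates
import Summits.RiemannHypothesis.RiemannHypothesis.Theses.EtaTailTrialBound
import Literature.NumberTheory.LFunctions.MontgomeryZeroSideProofs

/-!
# The locking layer with the Euler (halved) ending, II: the route decl `LockingLayer`
(route EtaTailTrialBound, item stmt-RiemannHypothesis-23083 ← 21599 restated rev 1 — RH-free)

For the re-locked layer `e'_M = layerH M` of `EtaTailTrialBoundDefs.lean` (the explicit Gaussian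
log-scale profile `g_M`, mass `D_M`, of the weak twin `EtaLeadingQuarterWeakLockingLayer*.lean`,
with amplitude `A'_M = L'_M/D_M`, `L'_M` the halved-ending locking constant):

* `L'_M = L_M + (−1)^M M^{−1/2}/2`, `|L'_M| ≤ 3/2`; exact locking `∑_{m=2}^{M} e'_M(m) = L'_M`
  (`M ≥ 2`); energy `∑ e'_M(m)² ≤ (9/4)/D_M`;
* the zero-side functional factors as `A'_M² · ∑'_ρ m γ^{-2} ‖D_c(γ)‖²` exactly as for the weak
  twin, and the fixed-`M` three-range bound `EtaLeadingQuarter.Locking.zeroSide_le` with the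
  bookkeeping of part I gives, for `log M ≥ 150`,
  `M · A'_M² · ∑'_ρ m γ^{-2}‖D_c(γ)‖² ≤ K (log M)³ M^{−1/15}`, `K = 365 ∑'_ρ m/γ² + 730 + 432 A`
  (`A` = the tree's local zero-density constant, `Montgomery.exists_zetaZeroCount_add_one_sub_le`),
  and `log M · ∑ e'² ≤ (9/4)(log M)³ M^{−1/15}`;
* hence `log M · ∑ e'_M(m)² → 0` and `M log M · ∑'_ρ m(ρ) γ_ρ^{-2} |∑_m e'_M(m) m^{iγ_ρ}|² → 0`
  (`tendsto_log_mul_zeroSide`, bound `K (log M)⁴ M^{−1/15}`) — the route decl `LockingLayer` in its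
  rev-1 typing (clause (iii) at rate `M log M`, the logarithm being what the trial-vector assembly's
  Cauchy–Schwarz cross term consumes; the STRONG twin of EtaLeadingQuarter's `WeakLockingLayer`),
  theorem `lockingLayer_proof`.

RH is not proved by this file and nothing here bears on the truth of RH: the statement is an
RH-free harmonic-analysis lemma about one explicit family of real Dirichlet polynomials at the
zeros of `ζ`.
-/

noncomputable section

open Complex MeasureTheory Set Filter Finset intervalIntegral
open scoped Real Topology ComplexConjugate

set_option linter.dupNamespace false  -- the mandated namespace repeats `RiemannHypothesis`

namespace Summit.RiemannHypothesis.RiemannHypothesis.Theorems.EtaTailTrialBound.Locking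

open Literature.NumberTheory.LFunctions NicolasJExplicit SchoenfeldBound ZetaZeroTails
open Summit.RiemannHypothesis.RiemannHypothesis.Theorems.EtaLeadingQuarter.ZeroSide
open Summit.RiemannHypothesis.RiemannHypothesis.Theorems.EtaLeadingQuarter.Locking

/-! ## Elementary algebra of the layer -/

/-- **Exact locking**: `∑_{m=2}^{M} e'_M(m) = L'_M` for `M ≥ 2`. [folklore] -/
theorem sum_layerH {M : ℕ} (hM : 2 ≤ M) :
    ∑ m ∈ Finset.Icc 2 M, layerH M m = lockConstH M := by
  unfold layerH ampH
  rw [← Finset.mul_sum, ← mass, div_mul_cancel₀ _ (mass_pos hM).ne']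

/-- `L'_M = L_M + (−1)^M M^{−1/2}/2` for `M ≥ 2` (the halving only moves the last term). [folklore] -/
theorem lockConstH_eq {M : ℕ} (hM : 2 ≤ M) :
    lockConstH M = lockConst M + (1 / 2 : ℝ) * (-1 : ℝ) ^ M * (M : ℝ) ^ (-(1 / 2 : ℝ)) := by
  unfold lockConstH lockConst
  have h : ∀ m ∈ Finset.Icc 2 M,
      (if m = M then (1 / 2 : ℝ) else 1) * (-1 : ℝ) ^ m * (m : ℝ) ^ (-(1 / 2 : ℝ)) =
        (-1 : ℝ) ^ m * (m : ℝ) ^ (-(1 / 2 : ℝ)) -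
          (if m = M then (1 / 2 : ℝ) * (-1 : ℝ) ^ m * (m : ℝ) ^ (-(1 / 2 : ℝ)) else 0) := by
    intro m _
    split_ifs <;> ring
  rw [Finset.sum_congr rfl h, Finset.sum_sub_distrib, Finset.sum_ite_eq' (Finset.Icc 2 M) M,
    if_pos (Finset.mem_Icc.2 ⟨hM, le_rfl⟩)]
  ring

/-- **`|L'_M| ≤ 3/2`** (`|L_M| ≤ 1` by Leibniz, `M^{−1/2}/2 ≤ 1/2`). [folklore] -/
theorem abs_lockConstH_le (M : ℕ) : |lockConstH M| ≤ 3 / 2 := by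
  rcases Nat.lt_or_ge M 2 with h | h
  · have he : Finset.Icc 2 M = ∅ := Finset.Icc_eq_empty (by omega)
    simp only [lockConstH, he, Finset.sum_empty, sub_zero, abs_one]
    norm_num
  rw [lockConstH_eq h]
  have h1 := abs_lockConst_le M
  have hM1 : (1 : ℝ) ≤ M := by exact_mod_cast (show 1 ≤ M by omega)
  have h3 : (M : ℝ) ^ (-(1 / 2 : ℝ)) ≤ 1 := Real.rpow_le_one_of_one_le_of_nonpos hM1 (by norm_num)
  have h4 : 0 ≤ (M : ℝ) ^ (-(1 / 2 : ℝ)) := Real.rpow_nonneg (Nat.cast_nonneg M) _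
  have h2 : |(1 / 2 : ℝ) * (-1 : ℝ) ^ M * (M : ℝ) ^ (-(1 / 2 : ℝ))| ≤ 1 / 2 := by
    rw [abs_mul, abs_mul, abs_pow, abs_neg, abs_one, one_pow, mul_one, abs_of_nonneg h4,
      abs_of_pos (by norm_num : (0 : ℝ) < 1 / 2)]
    linarith
  calc |lockConst M + 1 / 2 * (-1) ^ M * (M : ℝ) ^ (-(1 / 2 : ℝ))|
      ≤ |lockConst M| + |1 / 2 * (-1) ^ M * (M : ℝ) ^ (-(1 / 2 : ℝ))| := abs_add_le _ _
    _ ≤ 3 / 2 := by linarith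

/-- `A'_M² ≤ (9/4)/D_M²`. [folklore] -/
theorem ampH_sq_le (M : ℕ) : ampH M ^ 2 ≤ (9 / 4) / mass M ^ 2 := by
  unfold ampH
  rw [div_pow]
  refine div_le_div_of_nonneg_right ?_ (sq_nonneg _)
  have h := abs_lockConstH_le M
  calc lockConstH M ^ 2 = |lockConstH M| ^ 2 := (sq_abs _).symm
    _ ≤ (3 / 2) ^ 2 := pow_le_pow_left₀ (abs_nonneg _) h 2
    _ = 9 / 4 := by norm_num

/-- **Energy**: `∑_{m=2}^{M} e'_M(m)² ≤ (9/4)/D_M` (`M ≥ 2`; `g² ≤ g`). [folklore] -/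
theorem sum_layerH_sq_le {M : ℕ} (hM : 2 ≤ M) :
    ∑ m ∈ Finset.Icc 2 M, layerH M m ^ 2 ≤ (9 / 4) / mass M := by
  have hD := mass_pos hM
  have h1 : ∑ m ∈ Finset.Icc 2 M, layerH M m ^ 2 =
      ampH M ^ 2 * ∑ m ∈ Finset.Icc 2 M, bump M m ^ 2 := by
    rw [Finset.mul_sum]
    refine Finset.sum_congr rfl fun m _ ↦ ?_
    unfold layerH; ring
  have h2 : ∑ m ∈ Finset.Icc 2 M, bump M m ^ 2 ≤ mass M :=
    Finset.sum_le_sum fun m _ ↦ by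
      have h0 := (bump_pos M m).le
      have h1 := bump_le_one M m
      nlinarith
  rw [h1]
  calc ampH M ^ 2 * ∑ m ∈ Finset.Icc 2 M, bump M m ^ 2 ≤ (9 / 4) / mass M ^ 2 * mass M :=
        mul_le_mul (ampH_sq_le M) h2 (Finset.sum_nonneg fun m _ ↦ sq_nonneg _) (by positivity)
    _ = (9 / 4) / mass M := by
        field_simp

/-! ## The Dirichlet polynomial and the zero-side functional of the statement -/

/-- `‖∑_{m=2}^{M} e'_M(m) m^{iγ}‖ = |A'_M| · ‖D_c(γ)‖` with `c = coeff M`. [folklore] -/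
theorem norm_sum_layerH_cpow (M : ℕ) (γ : ℝ) :
    ‖∑ m ∈ Finset.Icc 2 M, ((layerH M m : ℝ) : ℂ) * (m : ℂ) ^ (((γ : ℝ) : ℂ) * I)‖ =
      |ampH M| * ‖dirPoly (coeff M) M γ‖ := by
  have h : ∑ m ∈ Finset.Icc 2 M, ((layerH M m : ℝ) : ℂ) * (m : ℂ) ^ (((γ : ℝ) : ℂ) * I) =
      ((ampH M : ℝ) : ℂ) *
        ∑ m ∈ Finset.Icc 2 M, ((bump M m : ℝ) : ℂ) * (m : ℂ) ^ (((γ : ℝ) : ℂ) * I) := by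
    rw [Finset.mul_sum]
    refine Finset.sum_congr rfl fun m _ ↦ ?_
    unfold layerH; push_cast; ring
  rw [h, norm_mul, Complex.norm_real, Real.norm_eq_abs, sum_bump_cpow_eq, norm_dirPoly_neg]

/-- The zero-side functional of the statement factors as `A'_M² · ∑'_ρ m γ^{-2} ‖D_c(γ)‖²`.
[folklore] -/
theorem tsum_layerH_eq (M : ℕ) :
    ∑' ρ : ZetaZeros.riemannZetaNontrivialZeros,
        (riemannZetaZeroOrder (ρ : ℂ) : ℝ) / (ρ : ℂ).im ^ 2 *
          ‖∑ m ∈ Finset.Icc 2 M, ((layerH M m : ℝ) : ℂ) * (m : ℂ) ^ ((((ρ : ℂ).im : ℝ) : ℂ) * I)‖ ^ 2 =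
      ampH M ^ 2 * ∑' ρ : Zeros,
        (riemannZetaZeroOrder (ρ : ℂ) : ℝ) / (ρ : ℂ).im ^ 2 * ‖dirPoly (coeff M) M (ρ : ℂ).im‖ ^ 2 := by
  rw [← tsum_mul_left]
  exact tsum_congr fun ρ ↦ by rw [norm_sum_layerH_cpow, mul_pow, sq_abs]; ring

/-- `0 ≤ ∑'_ρ m γ^{-2} ‖D_c(γ)‖²`. [folklore] -/
theorem zeroSide_nonneg (M : ℕ) :
    0 ≤ ∑' ρ : Zeros,
      (riemannZetaZeroOrder (ρ : ℂ) : ℝ) / (ρ : ℂ).im ^ 2 * ‖dirPoly (coeff M) M (ρ : ℂ).im‖ ^ 2 :=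
  tsum_nonneg fun ρ ↦ mul_nonneg (zeroOrder_div_im_sq_nonneg ρ) (sq_nonneg _)

/-! ## The zero side and the energy at a fixed large `M` -/

/-- **The zero side at a fixed `M` with `log M ≥ 150`.** With `Z₀ = ∑'_ρ m/γ²`, the local
zero-density constant `A` (`N(t+1) − N(t) ≤ A log(t+2)`) and `K = 365 Z₀ + 730 + 432 A`:
`M · A'_M² · ∑'_ρ m γ^{-2} ‖D_c(γ)‖² ≤ K · (log M)³ e^{−(log M)/15}`. [folklore] -/
theorem zeroSide_layerH_le {M : ℕ} (hL : 150 ≤ Real.log M) {A : ℝ} (hA0 : 0 ≤ A)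
    (hA : ∀ t : ℝ, 0 ≤ t → (zetaZeroCount (t + 1) : ℝ) - zetaZeroCount t ≤ A * Real.log (t + 2)) :
    (M : ℝ) * (ampH M ^ 2 * ∑' ρ : Zeros,
        (riemannZetaZeroOrder (ρ : ℂ) : ℝ) / (ρ : ℂ).im ^ 2 * ‖dirPoly (coeff M) M (ρ : ℂ).im‖ ^ 2) ≤
      (365 * (∑' ρ : Zeros, (riemannZetaZeroOrder (ρ : ℂ) : ℝ) / (ρ : ℂ).im ^ 2) + 730 + 432 * A) *
        (Real.log M ^ 3 * Real.exp (-(Real.log M / 15))) := by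
  have hs1 := one_le_width hL
  have hD := mass_ge' hL
  have hM1 : 1 ≤ M := by
    by_contra h
    rw [not_le] at h
    interval_cases M
    norm_num at hL
  have hM0 : (0 : ℝ) < M := by exact_mod_cast hM1
  have hMexp : (M : ℝ) = Real.exp (Real.log M) := (Real.exp_log hM0).symm
  have hZ0 : 0 ≤ ∑' ρ : Zeros, (riemannZetaZeroOrder (ρ : ℂ) : ℝ) / (ρ : ℂ).im ^ 2 :=
    tsum_nonneg fun ρ ↦ zeroOrder_div_im_sq_nonneg ρ
  have hB := zeroSide_le hL hA0 hA
  have h1 := term1_le hL hs1 hD hZ0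
  have h2 := term2_le hL hs1 hD
  have h3 := term3_le hL hs1 hD hA0
  have h4 := term4_le hL hs1 hD
  rw [← hMexp] at h1 h2 h3 h4
  have h := master_of_terms hM0.le (sq_nonneg _) (ampH_sq_le M) (zeroSide_nonneg M) hB h1 h2 h3 h4
  refine h.trans (le_of_eq ?_)
  ring

/-- **The energy at a fixed `M` with `log M ≥ 150`**: `log M · ∑ e'_M(m)² ≤ (9/4)(log M)³e^{−(log M)/15}`.
[folklore] -/
theorem energy_layerH_le {M : ℕ} (hL : 150 ≤ Real.log M) :
    Real.log M * ∑ m ∈ Finset.Icc 2 M, layerH M m ^ 2 ≤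
      (9 / 4) * (Real.log M ^ 3 * Real.exp (-(Real.log M / 15))) := by
  have hs1 := one_le_width hL
  have hD := mass_ge' hL
  have hM2 : 2 ≤ M := by
    by_contra h
    rw [not_le] at h
    interval_cases M <;> norm_num at hL
  calc Real.log M * ∑ m ∈ Finset.Icc 2 M, layerH M m ^ 2 ≤ Real.log M * ((9 / 4) / mass M) :=
        mul_le_mul_of_nonneg_left (sum_layerH_sq_le hM2) (Real.log_natCast_nonneg M)
    _ ≤ (9 / 4) * (Real.log M ^ 3 * Real.exp (-(Real.log M / 15))) := energy_rate hL hs1 hD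

/-! ## The limits -/

/-- The common rate: `K · (log M)ⁿ e^{−(log M)/15} → 0` (`M → ∞`). [folklore] -/
theorem tendsto_rate (K : ℝ) (n : ℕ) :
    Tendsto (fun M : ℕ ↦ K * (Real.log M ^ n * Real.exp (-(Real.log M / 15)))) atTop (𝓝 0) := by
  have h1 : Tendsto (fun M : ℕ ↦ Real.log (M : ℝ)) atTop atTop :=
    Real.tendsto_log_atTop.comp tendsto_natCast_atTop_atTop
  have h2 : Tendsto (fun M : ℕ ↦ Real.log (M : ℝ) / 15) atTop atTop := h1.atTop_div_const (by norm_num)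
  have h3 := ((Real.tendsto_pow_mul_exp_neg_atTop_nhds_zero n).comp h2).const_mul (K * 15 ^ n)
  rw [mul_zero] at h3
  refine h3.congr fun M ↦ ?_
  simp only [Function.comp_apply]
  rw [div_pow]
  field_simp

/-- **Energy**: `log M · ∑_{m=2}^{M} e'_M(m)² → 0`. [folklore] -/
theorem tendsto_log_mul_energy :
    Tendsto (fun M : ℕ ↦ Real.log M * ∑ m ∈ Finset.Icc 2 M, layerH M m ^ 2) atTop (𝓝 0) := by
  refine tendsto_of_tendsto_of_tendsto_of_le_of_le' tendsto_const_nhds (tendsto_rate (9 / 4) 3) ?_ ?_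
  · exact Eventually.of_forall fun M ↦
      mul_nonneg (Real.log_natCast_nonneg M) (Finset.sum_nonneg fun m _ ↦ sq_nonneg _)
  · filter_upwards [(Real.tendsto_log_atTop.comp tendsto_natCast_atTop_atTop).eventually_ge_atTop
      150] with M hL
    exact energy_layerH_le hL

/-- **Invisibility at the zeros with a logarithm to spare, rate `M log M`**:
`M log M · ∑'_ρ m(ρ) γ_ρ^{-2} ‖∑_{m=2}^{M} e'_M(m) m^{iγ_ρ}‖² → 0` (RH-free; the bound is
`K (log M)⁴ M^{−1/15}`). This is clause (iii) of the rev-1 route decl: the logarithm is what the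
trial-vector assembly's Cauchy–Schwarz cross-term step `2√(M Z(T)·M Z(E))` with `M Z(T) = O(log M)`
consumes (refuter note on stmt-RiemannHypothesis-21599, 2026-08-27; restated as 23083). [folklore] -/
theorem tendsto_log_mul_zeroSide :
    Tendsto (fun M : ℕ ↦ (M : ℝ) * Real.log M * ∑' ρ : ZetaZeros.riemannZetaNontrivialZeros,
      (riemannZetaZeroOrder (ρ : ℂ) : ℝ) / (ρ : ℂ).im ^ 2 *
        ‖∑ m ∈ Finset.Icc 2 M, ((layerH M m : ℝ) : ℂ) * (m : ℂ) ^ ((((ρ : ℂ).im : ℝ) : ℂ) * I)‖ ^ 2)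
      atTop (𝓝 0) := by
  obtain ⟨A, hA0, hA⟩ := Montgomery.exists_zetaZeroCount_add_one_sub_le
  refine tendsto_of_tendsto_of_tendsto_of_le_of_le' tendsto_const_nhds
    (tendsto_rate (365 * (∑' ρ : Zeros, (riemannZetaZeroOrder (ρ : ℂ) : ℝ) / (ρ : ℂ).im ^ 2) +
      730 + 432 * A) 4) ?_ ?_
  · refine Eventually.of_forall fun M ↦ ?_
    rw [tsum_layerH_eq]
    exact mul_nonneg (mul_nonneg (Nat.cast_nonneg M) (Real.log_natCast_nonneg M))
      (mul_nonneg (sq_nonneg _) (zeroSide_nonneg M))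
  · filter_upwards [(Real.tendsto_log_atTop.comp tendsto_natCast_atTop_atTop).eventually_ge_atTop
      150] with M hL
    rw [tsum_layerH_eq]
    have h := mul_le_mul_of_nonneg_left (zeroSide_layerH_le hL hA0.le hA) (Real.log_natCast_nonneg M)
    calc (M : ℝ) * Real.log M * (ampH M ^ 2 * ∑' ρ : Zeros,
            (riemannZetaZeroOrder (ρ : ℂ) : ℝ) / (ρ : ℂ).im ^ 2 * ‖dirPoly (coeff M) M (ρ : ℂ).im‖ ^ 2)
        = Real.log M * ((M : ℝ) * (ampH M ^ 2 * ∑' ρ : Zeros,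
            (riemannZetaZeroOrder (ρ : ℂ) : ℝ) / (ρ : ℂ).im ^ 2 * ‖dirPoly (coeff M) M (ρ : ℂ).im‖ ^ 2)) := by
          ring
      _ ≤ Real.log M * ((365 * (∑' ρ : Zeros, (riemannZetaZeroOrder (ρ : ℂ) : ℝ) / (ρ : ℂ).im ^ 2) +
            730 + 432 * A) * (Real.log M ^ 3 * Real.exp (-(Real.log M / 15)))) := h
      _ = (365 * (∑' ρ : Zeros, (riemannZetaZeroOrder (ρ : ℂ) : ℝ) / (ρ : ℂ).im ^ 2) + 730 + 432 * A) *
            (Real.log M ^ 4 * Real.exp (-(Real.log M / 15))) := by ring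

/-! ## The route decl -/

/-- **`LockingLayer` (route EtaTailTrialBound, item stmt-RiemannHypothesis-23083, the rev-1 restatement
of 21599), proved RH-free.** The witness is the explicit re-locked Gaussian log-scale layer
`e'_M = layerH M`: exact locking to the halved-ending constant for every `M ≥ 2`,
`log M · ∑ e'² → 0`, `M log M · Z_M(e') → 0`.
This closes an RH-free harmonic-analysis item; RH is not proved by it. [folklore] -/
theorem lockingLayer_proof :
    Summit.RiemannHypothesis.RiemannHypothesis.Theses.EtaTailTrialBound.LockingLayer := by
  unfold Summit.RiemannHypothesis.RiemannHypothesis.Theses.EtaTailTrialBound.LockingLayer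
  refine ⟨layerH, ?_, tendsto_log_mul_energy, tendsto_log_mul_zeroSide⟩
  filter_upwards [eventually_ge_atTop 2] with M hM
  rw [sum_layerH hM]
  rfl

end Summit.RiemannHypothesis.RiemannHypothesis.Theorems.EtaTailTrialBound.Locking

end
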